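import Summits.BirchSwinnertonDyer.Rank1Residual.F1Sign2.LocalKernelTwoTorsionAtTwo
import Summits.BirchSwinnertonDyer.Rank1Residual.F1Sign2.LayerOneNormIndexFloorAtTwo
import Literature.NumberTheory.EllipticCurves.Greenberg1999.ControlLocalKernelAtPStructure
import HarnessLib

/-!
# Cell `bsd-f1-sign2`, lens `-imc` g5 (MEMO-imc §10.34–§10.35): IMC-LKε — the SYMBOL LAW for the local tower kernel
# at a good ORDINARY `2` (decides IMC-LKC), and its OFF half IMC-LKε⁻

STATEMENTS ONLY (typed `Prop`s with bodies — carriers `LocalKernelAtTwoCyclicAt` / `LocalKernelAtTwoCyclic` (= g4's IMC-LKC, per curve and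
universal), `LocalKernelTwoTorsionCardAtTwoEq`, `DiscNonNormFromFirstLayerAtTwo`; the candidate THEOREM `LocalKernelSymbolLawAtTwo` (IMC-LKε) and
its OFF half `LocalKernelOneBitOffNormAtTwo` (IMC-LKε⁻) — nothing asserted, no `@[conjecture]` (the planner types IMC-LKε as a candidate theorem whose
inputs are local Tate duality, Kummer theory and the Hilbert-symbol projection formula, none a conjecture); eight glue theorems PROVED in-file; one
arithmetic `example`; no named Literature fact, no `sorry`).

TYPER FILING (seat `bsd-f1-sign2-ty` g4; CANDIDATES.md rows IMC-LKε / IMC-LKε⁻ / IMC-LKC): bodies VERBATIM from the planner's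
`HOME/MEMO-imc-data/SketchG5-LKEps.lean` dcd54d2804d703fc (-imc g5 2026-08-28T00:39:43Z, MEMO-imc §10.34–§10.35, memo 19b15bf88587cd1d; lean rc 0 / 0 sorry,
BC7 3/3 CLEAN per -imc `ProbeG5_BC7`); edits = this header, the cell namespace `Summit.BirchSwinnertonDyer.Rank1Residual.F1Sign2` in place of the
sketch's scratch namespace `…BirchSwinnertonDyer.Theses.F1Sign2.SketchG5LKEps` (and its `linter.dupNamespace` option, needed only there), and ONE
docstring added on `localKernelOneBitOffNormAtTwo_of_law` (gate `lint.docstring`). Imports kept as in the sketch. DEDUP NOTE: the bookkeeping lemma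
`natCard_nsmul_eq_zero_le_of_isAddCyclic` also exists in `Greenberg1999/ControlLocalKernelsLayer.lean` :330 but is `private` there (not importable),
so the sketch's copy is kept under the cell namespace. PLACEMENT RULING (typer = literature-prover, R2-G44): filed HERE, Summit-side, as a cell statement
over the Literature carrier `WeierstrassCurve.localTowerKerPrimary` — NOT a Literature fact: REF2 finds the STATEMENT nowhere in print (only its
ingredients), so there is no source to vendor it from verbatim; the upgrade path is a `Theorems/` proof from vendored as-printed steps (Greenberg §2
devissage, L.3.4 proof, cup product = Hilbert symbol, projection formula), each with its page. REF1-AUDIT-v1 §51 (25d72f00a784fb5b, 2026-08-28T01:02:59Z, D-ref1-imc-8 ANSWERED; evidence `HOME/REF1-data/b48/`): IMC-LKε `LocalKernelSymbolLawAtTwo` + IMC-LKε⁻ `LocalKernelOneBitOffNormAtTwo` (SketchG5-LKEps dcd54d2804d703fc) **SURVIVE — THEOREM-GRADE, in-print assembly**; sketch as-is rc 0 / 0 err / 0 warn / 0 sorry; BC7 3/3 CLEAN (Probe_LKEps 349ce3ef36e1d3da); guards G1–G6 kernel-checked (ON/OFF carriers disjoint and exhaust odd `Δ`; `(2,m)₂`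 table mod 16; OFF half = projection; `(2+c)(2−c) = 2−c_n`); A2: the three MEMO-imc §10.35 (h) proof spots (F3, `δ = η_E ∪ ·`, `N(2+ζ+ζ̄) = 2`) re-derived from Greenberg LNM 1716 pp. 73, 78, 80–81, 89 (held copy) — all correct; layer 0 of the ON half independently = Kramer 1981 Prop. 5 + L.3.4; hypotheses: `IsOrdinaryAt` load-bearing (supersingular `Δ ≡ 5 (mod 8)` is OFF but `𝒦` infinite), `IsGloballyMinimal` vacuity-only; witnesses 1727a1 ON `s = 1` / 2045b1 OFF `s = 1` / 3807c1, 9557a1 ON `s = 2`; «-ty g4 may FILE `F1Sign2/LocalKernelSymbolLawAtTwo.lean` as drafted». REF2-PLACEMENT v16 §40 (b89e4a96b0e014b2, 2026-08-28T00:49:45Z, D-ref2-imc-9): IMC-LKε `LocalKernelSymbolLawAtTwo` / IMC-LKε⁻ `LocalKernelOneBitOffNormAtTwo` = **NOT FOUND IN HOLDINGS as a statement; IN-PRINT ASSEMBLY as a proof** — planner's grade CONFIRMED; ingredients all printed (Greenberg §2 devissage «works even for p = 2» [coates1999 p0078], L.3.4 pp. 89–90; Kummer; connecting map = cup product, `χ_a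 ∪ χ_b = (a,b)_K` (Serre CL XIV, char-2-safe); `(u,Δ)_K = 1` for units via unramified norms (checked safe at residue characteristic 2); norm-compatibility; `N(2+ζ+ζ̄) = Φ_{2^{n+2}}(−1) = 2`; `(2,Δ)₂ = (−1)^{(Δ²−1)/8}`); layer 0 ⟺ Kramer 1981 Prop. 5 + L.3.4 (known); layers `n ≥ 1` + the STRUCTURE reading = a NEW SENTENCE on the documented search (Schneider 1987 Invent. 87 «Universal norm subgroups» cited ×6 but not held → acq-13619; Česnavičius–Imai 2016 / Kramer–Tunnell = quadratic layer only; galaxy 0); unread print that may decide it: Mazur 1972 §4 (acq-01035), Lubin–Rosen 1978 (acq-13596), Hazewinkel III (acq-13599), Schneider 1987 (acq-13619). Filing agreed: F1Sign2 cell statement, not a Literature fact; cite tags [Greenberg1999, Props 2.4–2.5, L.3.4] + [Kramer1981, Prop 5] as INGREDIENTS + «statement not located in print (REF2 v16 §40)». PARTITION: none moved; beyond-print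
theorem: no (candidate-small only if PROVED; worth in partition currency counted by MEMO-imc §10.37 X5-EPS-TEETH v1: +45 OPEN good-ordinary X5 classes
decidable at j′ ≤ 3, 26 classes 3→2, conditional on the law landing as a theorem). bears_on: `stmt-BirchSwinnertonDyer-22298` (C2 certificates on the
OFF stratum `Δ ≡ ±3 (mod 8)`, door `towerGapAtTwo_of_localKernelBounds_sharp` (hC) at `v ∋ 2` with `C_v = 2`: CERT-EPS(j′=3) fires on 11 OFF curves,
MEMO-imc §10.36).

Planner's summary (verbatim): # SKETCH (-imc g5, cell bsd-f1-sign2, MEMO-imc §10.35): **IMC-LKε — the symbol law for the local tower kernel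
# at a good ORDINARY 2** (decides g4's candidate IMC-LKC, MEMO-imc §10.33)

THE OBJECT.  `W/ℚ` globally minimal, good ordinary at `2`, `Δ = Δ_W` (an odd integer), `ℚ_∞/ℚ` the cyclotomic
`ℤ₂`-extension, `v_n` the unique prime of the layer `ℚ_n` over `2` (`K := (ℚ_n)_{v_n} = ℚ₂(ζ_{2^{n+2}})⁺`, totally
ramified, residue field `𝔽₂` at every layer), `𝒦_n := ker(r_{v_n}) = H¹(Gal(K_∞/K), E(K_∞))[2^∞]` = the tree's
`W.localTowerKerPrimary κ (v.adicCompletion ℚ) n` (docstring of `IwasawaSelmerControlLocalizationProofs`, p. 86).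
PRINT (Greenberg LNM 1716): `0 → ker a → 𝒦_n → ker d → 0`, `ker a = Im λ/Im λ_div ≅ Ẽ(𝔽₂)(2) =: D ≅ ℤ/2^s`
(Props. 2.2, 2.4, 2.5; "works even for p = 2", p. 78), `ker d = H¹(Γ_{v_n}, D) = Hom(Γ_{v_n}, D) ≅ ℤ/2^s`
(L.3.4 proof, p. 89; `a` surjective, `H²(K, C) = 0`), `s = v₂ #Ẽ(𝔽₂) = 1 (a₂ = +1), 2 (a₂ = −1, Ẽ(𝔽₂) ≅ ℤ/4)`;
tree: `lemma34_localTowerKerPrimary_cyclicExtension_rat` (+ order `|D|²`, `lemma34_natCard_localTowerKerPrimary_eq_rat`).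
Print decides the two cyclic PIECES and the ORDER, not the EXTENSION CLASS (g4, §10.33).

THE DECISION (g5, on paper; MEMO-imc §10.35).  `rank₂ 𝒦_n = 2` iff the order-2 class `ξ₂ = χ_{a_n} ⊗ P̃₂ ∈ ker d`
(`χ_{a_n}` = the quadratic character of `K_{n+1}/K_n = K(√a_n)`, `a_n = 2 + ζ_{2^{n+2}} + ζ̄`, `P̃₂` = the point
of order 2 of `D`) lifts to `H¹(K, E)[2] = Im H¹(K, E[2])`, i.e. iff `χ_{a_n}` or `χ_{a_n}·χ_ur` lies in
`ker(δ : H¹(K, Ẽ[2]) → H²(K, C[2]))` (`ker(H¹(K,Ẽ[2]) → H¹(K,Ẽ[2^∞])) = κ̃(D/2D) = ⟨χ_ur⟩`); `E[2]` is the extension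
of `Ẽ[2] = ℤ/2` by `C[2] = μ₂` with class `η_E ↔ Δ ∈ K*/K*²` (the 2-division cubic has the rational root `x(T₀)`,
`T₀ ∈ C[2]`, and splits over `K(√Δ)`), so `δ(χ_a) = χ_a ∪ η_E = (a, Δ)_K ∈ Br(K)[2]`; `(u_ur, Δ)_K = +1` (units are
norms from the unramified extension), and by the projection formula `(a_n, Δ)_{K} = (N_{K/ℚ₂} a_n, Δ)_{ℚ₂} = (2, Δ)_{ℚ₂}`
(`N_{ℚ_n/ℚ}(2 + ζ + ζ̄) = 2` for every `n`).  HENCE, for every layer `n ≥ 0`: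
  `#𝒦_n[2] = 4`  iff `(2, Δ_W)_{ℚ₂} = +1` iff `Δ_W ≡ ±1 (mod 8)` (= the tree's `DiscNormFromFirstLayerAtTwo W`);
  `#𝒦_n[2] = 2` and `𝒦_n` CYCLIC (`≅ ℤ/4^s`) iff `Δ_W ≡ ±3 (mod 8)`.
So g4's IMC-LKC(W, n) is TRUE iff `Δ_W ≡ ±3 (mod 8)` (at every `n` at once) — the «± object at a good ordinary 2»
read by the IMC lens is the symbol `ε(W) := (Δ_W, 2)_{ℚ₂}`, LAYER-INDEPENDENT, = Kramer's layer-1 norm-index bit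
(`i₂ = 1 + [ε = +1]`, Kramer 1981 Prop. 5 with `F = ℚ₂`, `d = 2`; the DESC lens' `normIndexAtTwoGood`, DESC-I) —
two lenses, one object.  CONSISTENCY: layer 0, `𝒦₀^{(1)} := ker(H¹(ℚ₂,E) → H¹(ℚ₂(√2),E)) ⊆ 𝒦₀[2]` has order `2^{i₂}`
(Kramer), and `2^{i₂} = #𝒦₀[2]` in all four cases `(a₂, ε)`; ON stratum of the cell (`N` odd … ⇒ `Δ ≡ 1 (mod 8)`,
MEMO-imc §10.29(c)(ii)): `ε = +1`, `𝒦 ≅ (ℤ/2)²` found independently in §10.29(c)(iv).  DATA (D-imc-12 rows, g5):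
all 17 thin-cell′ seeds, the 16 targets and the control 3807c1 have `Δ_min ≡ 1 (mod 8)` EXACTLY ⇒ `ε = +1` ⇒
IMC-LKC is FALSE on every seed at every layer (no third bit for 10913b1 / 17671a1); the OFF stratum (D-imc-11d,
51 curves, `Δ ≡ ±3 (mod 8)` by construction) gets the door constant `C₂ = 2`.
Nothing below is asserted: `def`s (the law as a named candidate THEOREM, to be proved in `Theorems/` — its inputs are
local Tate duality / Kummer theory / the Hilbert-symbol projection formula, none of which is a conjecture) and
kernel-checked projections.  [cite: GreenbergLNM1716, §2 Props. 2.2, 2.4, 2.5 (PDF pp. 73–81), §3 Lemma 3.4 (proof,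
p. 89)] [cite: Kramer1981, §2 Prop. 5 (p. 127)]
-/


set_option autoImplicit false

noncomputable section

open scoped Classical

open NumberField IsDedekindDomain Literature.NumberTheory.EllipticCurves
  Literature.NumberTheory.EllipticCurves.Greenberg1999
  Summit.BirchSwinnertonDyer.Rank1Residual.F1Sign2

universe u

namespace Summit.BirchSwinnertonDyer.Rank1Residual.F1Sign2

/-! ## §1 Carriers -/

/-- **IMC-LKC(W, n)** (g4, verbatim): the local tower kernel `𝒦_{v,n}[2^∞]` at `v ∋ 2` of layer `n` is cyclic.
[cite: GreenbergLNM1716, §3 Lemma 3.4 (proof, PDF p. 89)] -/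
def LocalKernelAtTwoCyclicAt (W : WeierstrassCurve ℚ) [W.IsElliptic] [W.IsGloballyMinimal] (n : ℕ) : Prop :=
  ∀ (κ : ZpExtension ℚ 2), κ.IsCyclotomic → ∀ v : HeightOneSpectrum (𝓞 ℚ), ((2 : ℕ) : 𝓞 ℚ) ∈ v.asIdeal →
    IsAddCyclic (W.localTowerKerPrimary κ (v.adicCompletion ℚ) n)

/-- **IMC-LKC, universal form** (g4, verbatim) — DECIDED FALSE by the symbol law (`not_localKernelAtTwoCyclic_of_law`).
[cite: GreenbergLNM1716, §3 Lemma 3.4 (proof, PDF p. 89)] -/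
def LocalKernelAtTwoCyclic : Prop :=
  ∀ (W : WeierstrassCurve ℚ) [W.IsElliptic] [W.IsGloballyMinimal], IsOrdinaryAt W 2 →
    ∀ n : ℕ, LocalKernelAtTwoCyclicAt W n

/-- `#𝒦_{v,n}[2] = c` at the place(s) `v ∋ 2` of layer `n` (with finiteness of `𝒦_{v,n}[2^∞]`, L.3.4), in the
currency of the doors `towerGapAtTwo_of_localKernelBounds_sharp` / `_cert`. [cite: GreenbergLNM1716, §3 Lemma 3.4 (PDF p. 89)] -/
def LocalKernelTwoTorsionCardAtTwoEq (W : WeierstrassCurve ℚ) [W.IsElliptic] [W.IsGloballyMinimal]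
    (n c : ℕ) : Prop :=
  ∀ (κ : ZpExtension ℚ 2), κ.IsCyclotomic → ∀ v : HeightOneSpectrum (𝓞 ℚ), ((2 : ℕ) : 𝓞 ℚ) ∈ v.asIdeal →
    Finite (W.localTowerKerPrimary κ (v.adicCompletion ℚ) n) ∧
      Nat.card {x : W.localTowerKerPrimary κ (v.adicCompletion ℚ) n // 2 • x = 0} = c

/-- `(Δ_W, 2)_{ℚ₂} = −1` for an odd integral discriminant: `Δ_W ≡ ±3 (mod 8)` — `Δ_W` is NOT a norm from the first
local layer `ℚ₂(√2)` (complement of the tree's `DiscNormFromFirstLayerAtTwo` among odd integral `Δ`).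
[cite: Kramer1981, §2 Prop. 5 (p. 127)] -/
def DiscNonNormFromFirstLayerAtTwo (W : WeierstrassCurve ℚ) : Prop :=
  ∃ m : ℤ, (m : ℚ) = W.Δ ∧ (m % 8 = 3 ∨ m % 8 = 5)

/-! ## §2 The candidate THEOREM (typed; to be proved in `Theorems/`) -/

/-- **IMC-LKε — SYMBOL LAW FOR THE LOCAL TOWER KERNEL AT A GOOD ORDINARY 2.** For `W/ℚ` globally minimal, good
ordinary at `2`, and EVERY layer `n` of the cyclotomic `ℤ₂`-tower: if `Δ_W ≡ ±1 (mod 8)` then `#𝒦_{v,n}[2] = 4`;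
if `Δ_W ≡ ±3 (mod 8)` then `#𝒦_{v,n}[2] = 2` and `𝒦_{v,n}` is cyclic.  (Proof sketch in the module docstring:
Greenberg's devissage + `δ = ∪ η_E` + `(a_n, Δ)_{K_n} = (2, Δ)_{ℚ₂}`.)  Candidate theorem, nothing asserted.
[cite: GreenbergLNM1716, §2 Props. 2.2, 2.4, 2.5, §3 Lemma 3.4 (proof, PDF p. 89)] [cite: Kramer1981, §2 Prop. 5 (p. 127)] -/
def LocalKernelSymbolLawAtTwo : Prop :=
  ∀ (W : WeierstrassCurve ℚ) [W.IsElliptic] [W.IsGloballyMinimal], IsOrdinaryAt W 2 → ∀ n : ℕ,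
    (DiscNormFromFirstLayerAtTwo W → LocalKernelTwoTorsionCardAtTwoEq W n 4) ∧
    (DiscNonNormFromFirstLayerAtTwo W → LocalKernelTwoTorsionCardAtTwoEq W n 2 ∧ LocalKernelAtTwoCyclicAt W n)

/-- **IMC-LKε⁻ (the OFF half alone)** — the part the certificates consume: `Δ_W ≡ ±3 (mod 8) ⇒ #𝒦_{v,n}[2] = 2`.
[cite: GreenbergLNM1716, §3 Lemma 3.4 (proof, PDF p. 89)] -/
def LocalKernelOneBitOffNormAtTwo : Prop :=
  ∀ (W : WeierstrassCurve ℚ) [W.IsElliptic] [W.IsGloballyMinimal], IsOrdinaryAt W 2 →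
    DiscNonNormFromFirstLayerAtTwo W → ∀ n : ℕ, LocalKernelTwoTorsionCardAtTwoEq W n 2

/-- IMC-LKε ⇒ IMC-LKε⁻ (projection to the OFF half). -/
theorem localKernelOneBitOffNormAtTwo_of_law (hlaw : LocalKernelSymbolLawAtTwo) :
    LocalKernelOneBitOffNormAtTwo :=
  fun W _ _ hord hΔ n ↦ ((hlaw W hord n).2 hΔ).1

/-! ## §3 Kernel-checked projections -/

/-- In a finite cyclic additive group the elements killed by `m ≠ 0` number at most `m`. [folklore] -/
theorem natCard_nsmul_eq_zero_le_of_isAddCyclic {G : Type u} [AddCommGroup G] [Finite G] [IsAddCyclic G]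
    {m : ℕ} (hm : m ≠ 0) : Nat.card {x : G // m • x = 0} ≤ m := by
  let H : AddSubgroup G := AddSubgroup.torsionBy G (m : ℤ)
  have hH : ∀ x : G, x ∈ H ↔ m • x = 0 := fun x ↦ AddSubgroup.torsionBy.nsmul_iff
  have hcard : Nat.card {x : G // m • x = 0} = Nat.card H :=
    Nat.card_congr (Equiv.subtypeEquivRight fun x ↦ (hH x).symm)
  haveI : IsAddCyclic H := AddSubgroup.isAddCyclic H
  have hexp : AddMonoid.exponent H ∣ m :=
    AddMonoid.exponent_dvd_of_forall_nsmul_eq_zero fun x ↦ Subtype.ext (by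
      rw [AddSubgroup.coe_nsmul, AddSubgroup.coe_zero]; exact (hH x.1).mp x.2)
  rw [hcard, ← IsAddCyclic.exponent_eq_card]
  exact Nat.le_of_dvd (Nat.pos_of_ne_zero hm) hexp

/-- **THE DOOR INPUT ON THE OFF STRATUM**: under IMC-LKε⁻, a good-ordinary-at-2 curve with `Δ ≡ ±3 (mod 8)`
satisfies the (hC) clause of `towerGapAtTwo_of_localKernelBounds_sharp` at `v ∋ 2` with ANY `C v ≥ 2` — one bit
better than the tree's `hC_at_two_of_LK2` (`C v ≥ 4`). [cite: GreenbergLNM1716, §3 Lemma 3.4 (proof, PDF p. 89)] -/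
theorem hC_at_two_of_oneBit (hbit : LocalKernelOneBitOffNormAtTwo)
    (W : WeierstrassCurve ℚ) [W.IsElliptic] [W.IsGloballyMinimal] (hord : IsOrdinaryAt W 2)
    (hΔ : DiscNonNormFromFirstLayerAtTwo W)
    (κ : ZpExtension ℚ 2) (hκ : κ.IsCyclotomic) (v : HeightOneSpectrum (𝓞 ℚ))
    (hv : ((2 : ℕ) : 𝓞 ℚ) ∈ v.asIdeal) (j' : ℕ) (C : HeightOneSpectrum (𝓞 ℚ) → ℕ) (hC : 2 ≤ C v) :
    Finite {x : W.localTowerKerPrimary κ (v.adicCompletion ℚ) j' // 2 • x = 0} ∧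
      Nat.card {x : W.localTowerKerPrimary κ (v.adicCompletion ℚ) j' // 2 • x = 0} ≤ C v := by
  obtain ⟨hfin, hcard⟩ := hbit W hord hΔ j' κ hκ v hv
  haveI := hfin
  exact ⟨Finite.of_injective (fun x ↦ x.1) Subtype.val_injective, hcard.le.trans hC⟩

/-- **IMC-LKε⁻ also re-derives the tree's constant** (`≤ 4`) on the OFF stratum — sanity that the currencies match. -/
theorem hC_at_two_four_of_oneBit (hbit : LocalKernelOneBitOffNormAtTwo)
    (W : WeierstrassCurve ℚ) [W.IsElliptic] [W.IsGloballyMinimal] (hord : IsOrdinaryAt W 2)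
    (hΔ : DiscNonNormFromFirstLayerAtTwo W) (κ : ZpExtension ℚ 2) (hκ : κ.IsCyclotomic)
    (v : HeightOneSpectrum (𝓞 ℚ)) (hv : ((2 : ℕ) : 𝓞 ℚ) ∈ v.asIdeal) (n : ℕ) :
    Nat.card {x : W.localTowerKerPrimary κ (v.adicCompletion ℚ) n // 2 • x = 0} ≤ 4 :=
  ((hbit W hord hΔ n κ hκ v hv).2.le).trans (by norm_num)

/-- **THE NEGATIVE DECISION**: under the symbol law, at a good-ordinary-at-2 curve with `Δ ≡ ±1 (mod 8)` the local
tower kernel is NOT cyclic at any layer (`#𝒦[2] = 4 > 2`). [cite: Kramer1981, §2 Prop. 5 (p. 127)] -/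
theorem not_isAddCyclic_of_law (hlaw : LocalKernelSymbolLawAtTwo)
    (W : WeierstrassCurve ℚ) [W.IsElliptic] [W.IsGloballyMinimal] (hord : IsOrdinaryAt W 2)
    (hΔ : DiscNormFromFirstLayerAtTwo W) (n : ℕ) (κ : ZpExtension ℚ 2) (hκ : κ.IsCyclotomic)
    (v : HeightOneSpectrum (𝓞 ℚ)) (hv : ((2 : ℕ) : 𝓞 ℚ) ∈ v.asIdeal) :
    ¬ IsAddCyclic (W.localTowerKerPrimary κ (v.adicCompletion ℚ) n) := by
  intro hcyc
  obtain ⟨hfin, hcard⟩ := (hlaw W hord n).1 hΔ κ hκ v hv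
  haveI := hfin
  haveI := hcyc
  have h2 : Nat.card {x : W.localTowerKerPrimary κ (v.adicCompletion ℚ) n // 2 • x = 0} ≤ 2 :=
    natCard_nsmul_eq_zero_le_of_isAddCyclic (G := W.localTowerKerPrimary κ (v.adicCompletion ℚ) n) two_ne_zero
  omega

/-- **`¬ IMC-LKC` (universal form)** from the law, given ONE good-ordinary-at-2 curve with `Δ ≡ ±1 (mod 8)` (every
thin-cell′ seed qualifies: `Δ_min ≡ 1 (mod 8)` on 17/17 — e.g. 1727a1 `[1,−1,0,−76,275]`, `Δ_min = −1727 ≡ 1 (mod 8)`)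
and the cyclotomic `ℤ₂`-extension and the prime over `2` supplied as witnesses. [cite: Kramer1981, §2 Prop. 5 (p. 127)] -/
theorem not_localKernelAtTwoCyclic_of_law (hlaw : LocalKernelSymbolLawAtTwo)
    (W : WeierstrassCurve ℚ) [W.IsElliptic] [W.IsGloballyMinimal] (hord : IsOrdinaryAt W 2)
    (hΔ : DiscNormFromFirstLayerAtTwo W) (κ : ZpExtension ℚ 2) (hκ : κ.IsCyclotomic)
    (v : HeightOneSpectrum (𝓞 ℚ)) (hv : ((2 : ℕ) : 𝓞 ℚ) ∈ v.asIdeal) :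
    ¬ LocalKernelAtTwoCyclic :=
  fun h ↦ not_isAddCyclic_of_law hlaw W hord hΔ 0 κ hκ v hv (h W hord 0 κ hκ v hv)

/-- **DECISION OF IMC-LKC(W, n) ON THE OFF STRATUM**: the law gives g4's per-curve hypothesis at every layer. -/
theorem localKernelAtTwoCyclicAt_of_law (hlaw : LocalKernelSymbolLawAtTwo)
    (W : WeierstrassCurve ℚ) [W.IsElliptic] [W.IsGloballyMinimal] (hord : IsOrdinaryAt W 2)
    (hΔ : DiscNonNormFromFirstLayerAtTwo W) (n : ℕ) : LocalKernelAtTwoCyclicAt W n :=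
  ((hlaw W hord n).2 hΔ).2

/-- The two discriminant classes are disjoint (an integer is not both `≡ ±1` and `≡ ±3 (mod 8)`). [folklore] -/
theorem not_discNorm_of_discNonNorm (W : WeierstrassCurve ℚ) (h : DiscNonNormFromFirstLayerAtTwo W) :
    ¬ DiscNormFromFirstLayerAtTwo W := by
  rintro ⟨m, hm, hm8⟩
  obtain ⟨m', hm', hm8'⟩ := h
  have : m = m' := by exact_mod_cast hm.trans hm'.symm
  subst this
  omega

/-- The `Int.emod` convention used by the two discriminant carriers (`(−3) % 8 = 5`, `(−1) % 8 = 7`), and the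
residues of two data rows: 1727a1 `Δ_min = −1727` (ON, `≡ 1`), 2045b1 `Δ_min = −312042236328125` (OFF, `≡ 3`). [folklore] -/
example : (-3 : ℤ) % 8 = 5 ∧ (-1 : ℤ) % 8 = 7 ∧ (-1727 : ℤ) % 8 = 1 ∧ (-312042236328125 : ℤ) % 8 = 3 := by decide

/-! ## Addendum (MEMO-imc §10.45 (b), 2026-08-28T02:45Z): the ≤-FORM of IMC-LKε⁻ — all that any door consumes

TYPER APPEND (seat `bsd-f1-sign2-ty` g4; -imc's «OPTIONAL 25-line addendum … so the doors can cite the ≤-form BY NAME»): the four declarations below are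
§2 of the planner's kernel-checked interface file `HOME/MEMO-imc-data/SketchG5-EpsInterface.lean` c416944bb08b72ab (rc 0 · 0 warn · 0 sorry per -imc, `.check.json`
4e49486670df4bbe) VERBATIM, minus `cardAtTwoLe_four_kernel` (the `c = 4` instance := the tree's kernel theorem
`…Theorems.GoodOrdTower.pTorsion_localTowerKer_at_two_le_four_kernel`, which stays with the wake seat so this file's import closure is unchanged).
STATUS: `LocalKernelTwoTorsionCardAtTwoLe` is a carrier (predicate); `LocalKernelOneBitOffNormAtTwoLe` («IMC-LKε⁻≤») is a plain `def … : Prop`, the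
door-currency WEAKENING of the statement of record `LocalKernelOneBitOffNormAtTwo` above (REF1-AUDIT §51: theorem-grade in-print assembly; the Eq/cyclic law
stays the statement of record) — implied by it (`oneBitLe_of_oneBit`, PROVED) and, per MEMO-imc §10.45 (a)/(c), UNCONDITIONALLY reachable on top of the tree's
GEN-11 kernel theorem by one arithmetic ε-step (hε) ≈ 400–600 lines (bsd-2adic wake seat «TAKING WAKE IMC-LKε»); `hC_at_two_of_oneBitLe` PROVED. Consumers BY
NAME: the thin ε-door `towerGapAtTwo_of_layerSelmer_cert_epsLe (hbitLe : LocalKernelOneBitOffNormAtTwoLe) …` (§3 of the interface file) and the 71 generated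
ε-door class sections of MEMO-imc §10.43 (`EpsDoorGen{A,B,C}.lean`, re-targeted by `oneBitLe_of_oneBit hbit` or `s/hbit/hbitLe/`). Nothing asserted; no new
Literature fact; PARTITION: none moved; beyond-print theorem: no. -/

/-- `#𝒦_{v,n}[2^∞][2] ≤ c` at the place(s) `v ∋ 2` of layer `n` — the shape of `GoodOrdTower.pTorsion_localTowerKer_at_two_le_four_kernel`
(`c = 4`, kernel theorem) and of the door input `h2` of `MultTowerCert.towerGapAtTwo_of_layerSelmer_cert_atTwo`. -/
def LocalKernelTwoTorsionCardAtTwoLe (W : WeierstrassCurve ℚ) [W.IsElliptic] [W.IsGloballyMinimal] (n c : ℕ) : Prop :=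
  ∀ (κ : ZpExtension ℚ 2), κ.IsCyclotomic → ∀ v : HeightOneSpectrum (𝓞 ℚ), ((2 : ℕ) : 𝓞 ℚ) ∈ v.asIdeal →
    Finite {x : W.localTowerKerPrimary κ (v.adicCompletion ℚ) n // 2 • x = 0} ∧
      Nat.card {x : W.localTowerKerPrimary κ (v.adicCompletion ℚ) n // 2 • x = 0} ≤ c

/-- **IMC-LKε⁻≤ — the wake seat's target in door currency**: good ordinary at `2`, `Δ_min ≡ ±3 (mod 8)` ⇒ `#𝒦_{v,n}[2^∞][2] ≤ 2` at every layer.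
(= `GoodOrdTower.pTorsion_localTowerKer_at_two_le_four_kernel` with `4 ↦ 2` under the extra hypothesis; no `Finite 𝒦`, no exactness, no cyclicity.)
[cite: GreenbergLNM1716, §3 Lemma 3.4 (proof, PDF p. 89)] [cite: Kramer1981, §2 Prop. 5 (p. 127)] -/
def LocalKernelOneBitOffNormAtTwoLe : Prop :=
  ∀ (W : WeierstrassCurve ℚ) [W.IsElliptic] [W.IsGloballyMinimal], IsOrdinaryAt W 2 →
    DiscNonNormFromFirstLayerAtTwo W → ∀ n : ℕ, LocalKernelTwoTorsionCardAtTwoLe W n 2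

/-- The tree's Eq-form (`F1Sign2.LocalKernelOneBitOffNormAtTwo`, p591873) implies the ≤-form. -/
theorem oneBitLe_of_oneBit (hbit : LocalKernelOneBitOffNormAtTwo) : LocalKernelOneBitOffNormAtTwoLe := by
  intro W _ _ hord hΔ n κ hκ v hv
  obtain ⟨hfin, hcard⟩ := hbit W hord hΔ n κ hκ v hv
  haveI := hfin
  exact ⟨Finite.of_injective (fun x ↦ x.1) Subtype.val_injective, hcard.le⟩

/-- The (hC)/`h2` clause at `v ∋ 2` from the ≤-form, for any displayed `C v ≥ 2`. -/
theorem hC_at_two_of_oneBitLe (hbit : LocalKernelOneBitOffNormAtTwoLe)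
    (W : WeierstrassCurve ℚ) [W.IsElliptic] [W.IsGloballyMinimal] (hord : IsOrdinaryAt W 2)
    (hΔ : DiscNonNormFromFirstLayerAtTwo W) (κ : ZpExtension ℚ 2) (hκ : κ.IsCyclotomic)
    (v : HeightOneSpectrum (𝓞 ℚ)) (hv : ((2 : ℕ) : 𝓞 ℚ) ∈ v.asIdeal) (j' : ℕ)
    (C : HeightOneSpectrum (𝓞 ℚ) → ℕ) (hC : 2 ≤ C v) :
    Finite {x : W.localTowerKerPrimary κ (v.adicCompletion ℚ) j' // 2 • x = 0} ∧
      Nat.card {x : W.localTowerKerPrimary κ (v.adicCompletion ℚ) j' // 2 • x = 0} ≤ C v :=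
  (hbit W hord hΔ j' κ hκ v hv).imp_right fun h ↦ h.trans hC


end Summit.BirchSwinnertonDyer.Rank1Residual.F1Sign2
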